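import Summits.QuantumFields.BalabanUV.T4Continuum.Support.NE7HintOfLandauSupChartSU2
import Summits.QuantumFields.BalabanUV.T4Continuum.Support.NE7CubeGradientLandauEL
import Summits.QuantumFields.BalabanUV.T4Continuum.Support.NE7CubeLandauMinimiser
import HarnessLib

/-!
# NE7 — (8)∃ FROM THE SUP LETTER OF THE CUBE LANDAU MINIMISER ALONE, SU(2)∕U(2) on T⁴, `L = 2` (F305): for every tangent-critical admissible configuration and every
# centre `z`, IF the trace-link minimising gauge on the sup-cube of radius `R₀ = (nbRad + 2ℓ + 12)·M + 2` (it EXISTS, F304, and satisfies the lattice Landau condition at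
# every site of the cube) reads `U^{u} = e^{A}` with `A` skew and `‖A‖ ≤ c₀t∕M` on the cube, THEN the reaction is ZERO (Euler–Lagrange), the gradient letter follows (F303,
# F301), the cube chart of F298 follows, and (8)∃ follows.  THE CHART INPUT OF ROUTE 1 IS NOW ONE LINE: the sup letter of a local Landau minimiser — a one-scale
# lattice Uhlenbeck ε-regularity statement in `L^∞`

Cell `pub-balaban`, rung (B)+1 sub-cell t4, lineage `b2b-balaban-t4-ne7-p1` (CRUX PROVER NE7 #1 = OWNER of row NE7), generation 92; memo
`t4/b2b-balaban-t4-ne7-p1-g92/LOG-OBSTRUCTION.md` §4 (ROAD (U): (B1) + the existence∕Euler–Lagrange half of (B2) assembled; the SUP LETTER is what remains).  Over F298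
`NE7HintOfCubeChartSU2.hint_of_cubeChart_SU2`, F301 `NE7ClassCurrentBound.exists_classCurrentConst`, F302 `NE7HintOfLandauSupChartSU2.gradLetter_arith`, F303
`NE7CubeGradientLandauEL.norm_fdiff_le_of_landauEL_cube`, F304 `NE7CubeLandauMinimiser` (`exists_cubeTraceLinkMinimiser`, `landau_of_isMin_cube`).

WHY.  F302 asked, besides the sup letter, a reaction letter `‖∇div A‖ ≤ c_r t∕M³`; the gauge one actually constructs — the minimiser of the smooth trace-link functional over
the site gauges supported on the cube (F304) — satisfies the Landau condition in Euler–Lagrange form `div_Q sinh A = 0`, for which F303 re-ran the weighted bootstrap.  So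
for THAT gauge the reaction hypothesis disappears and the chart input of route 1's END is exactly: «the cube Landau minimiser of a tangent-critical admissible configuration
has a skew logarithm with ‖A‖ ≤ c₀t∕M on the cube» (MSUP).  The cube has side `≍ (2ℓ+32)M` and the configuration has plaquettes `≤ r∕M²`, `r ≤ ε∕4`, with ε chosen
after ℓ: the scale-invariant curvature `(side)²·sup|F| ≍ ℓ²r` is as small as we please — the hypothesis of Uhlenbeck's Coulomb-gauge theorem, here to be proved on the
lattice in sup norm (memo §4 (B2): continuity method via the implicit function theorem on `(skew)^{cube}` + an a priori `L² → L^∞` improvement; or print's massive propagators).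
WHAT ([folklore] composition + arithmetic; 0 def, 0 sorry).  §1 `sinhDiv_eq_zero_of_EL` (the EL condition of F304 in the log chart: `Σ_κ [sinh A(y,κ) − sinh A(y−e_κ,κ)] = 0`).
§2 **`cubeChart_of_landauEL`** (F303 at `R₀`, depth `M`, current `C·r∕M³`, EL reaction: gradient `≤ (62c₀ + (2ℓ+32)²(2C + 32c₀ + 48))·t∕M²` on the cube of radius
`(nbRad+2ℓ+11)M`, regime `t ≤ 1∕(1152(2ℓ+32)(c₀+1))`).  §3 **`hint_of_landauMinSup_SU2`**: ∀ `A ≥ 0`, `p` ∃ `ℓ ≥ 1`, `ε₀ > 0` ∀ `0 < ε ≤ ε₀` ∃ `β₀ > 0` ∀ `0 < β ≤ β₀` ∀ `N ≥ 1`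
∀ `c₀ ∈ [0, A(ℓ+1)^p]`: route Π's two lines ∧ (MSUP on the `(4ℓ+64)`-fold cover) ∧ hleaves ⟹ (8)∃.
HONEST FRAMING (page 1): (MSUP) — the sup letter of the cube Landau minimiser — is a HYPOTHESIS (the target of ROAD (U) (B2)), asserted for nothing; hleaves ([B11] Prop 2
TYPE) likewise; nothing of Bałaban's asserted as an axiom; NE7 NOT PROVED unconditionally; spine 0∕9; finite T⁴ rung (B)+1 — NOT infinite volume, NOT mass gap, NOT
`BetaPertH`, NOT Clay.  Continuum YM on T⁴ ⇐ BetaPertH ∧ nine spine estimates (0/9 proved); BetaPertH ⇐ (D1) ∧ (D4) ∧ CAP+tail; G-an2-4 gates asym, D1 and NE2/3/4.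
No `sorry`; axioms ⊆ {propext, Classical.choice, Quot.sound}.
-/

set_option autoImplicit false

open scoped BigOperators Matrix Matrix.Norms.L2Operator Topology
open NormedSpace Finset Set Filter

namespace Summit.QuantumFields.BalabanUV.T4Continuum.NE7HintOfLandauMinSupSU2

open Literature.MathematicalPhysics.QuantumFieldTheory.Balaban1983to89
open B7Prop1Explicit B7Prop2Explicit MatrixLog UnitaryModel MatrixNorms
open B4TorusKernel.MultiPeriod (torusSupNorm)
open B8Ineq132 (covDiv)
open T4AveragingDeficitWall (Ad IsUnitaryCfg IsSkewDir SmallField vary curl curlSq dirSq dirL1)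
open T4AveragingDeficitWallBoundary (IsPeriodicCfg periodBox)
open AveragingDeficitPeriodicCounting (IsPeriodicDir)
open AveragingDeficitMultiLevelPrep (LevelSmall tower TangentIter)
open BlockAverageVaryHolo (nbRad)
open MinimalActionLevels (perWin)
open MinimalActionSandwich (IsMinimiser admissible)
open MinimalActionRate (sfClass)
open NE3HessForm (dAction)
open NE3SlicePoincareBudgetLine (CPLine)
open NE3TangentCovariantTower (dirIter)
open NE3DecomposedRepOfLinearNormalPart (ResidualSliceRepT)
open NE3QbarIterCovLiftPrep (cruxC)
open NE3SmoothRightInverseW (rightInvW)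
open NE3RightInverseSolveLetters (thetaLoc)
open NE3RightInverseL2Letter (l2C)
open NE3HatInvCurlLetters (curl2C curl1C)
open NE3EnergyShapes (IsUnitarySite)
open BlockAveragePushDirSplit (flat)
open NE7HintOfCubeChartSU2 (hint_of_cubeChart_SU2)
open NE7ClassCurrentBound (exists_classCurrentConst)
open NE7HintOfLandauSupChartSU2 (gradLetter_arith)
open NE7CubeGradientLandauEL (norm_fdiff_le_of_landauEL_cube)
open NE7CubeLandauMinimiser (exists_cubeTraceLinkMinimiser landau_of_isMin_cube)
open NE7LocalGradientBootstrap (mem_cube_iff)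
open Literature.NumberTheory.Sieve.SquarefreeSums (exp_sub_one_le_two_mul)

noncomputable section

variable {n : Type*} [Fintype n] [DecidableEq n]

/-! ## §1 The Euler–Lagrange condition in the log chart -/

/-- If `W(y,κ) = e^{A(y,κ)}` and `W(y−e_κ,κ) = e^{A(y−e_κ,κ)}` with these `A`'s skew, the lattice Landau condition
`Σ_κ [(W(y,κ) − W(y,κ)ᴴ) − (W(y−e_κ,κ) − W(y−e_κ,κ)ᴴ)] = 0` reads `Σ_κ [sinh A(y,κ) − sinh A(y−e_κ,κ)] = 0`. [folklore] -/
theorem sinhDiv_eq_zero_of_EL {d : ℕ} (W : Site d → Fin d → (Matrix n n ℂ)ˣ) (A : Site d → Fin d → Matrix n n ℂ) (y : Site d)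
    (hW : ∀ κ : Fin d, W y κ = expUnit (A y κ) ∧ W (y - e κ) κ = expUnit (A (y - e κ) κ))
    (hskew : ∀ κ : Fin d, A y κ ∈ skewAdjoint (Matrix n n ℂ) ∧ A (y - e κ) κ ∈ skewAdjoint (Matrix n n ℂ))
    (h : ∑ κ : Fin d, ((((W y κ : (Matrix n n ℂ)ˣ) : Matrix n n ℂ) - ((W y κ : (Matrix n n ℂ)ˣ) : Matrix n n ℂ)ᴴ)
      - (((W (y - e κ) κ : (Matrix n n ℂ)ˣ) : Matrix n n ℂ) - ((W (y - e κ) κ : (Matrix n n ℂ)ˣ) : Matrix n n ℂ)ᴴ)) = 0) :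
    ∑ κ : Fin d, (((2 : ℂ)⁻¹ • (exp (A y κ) - exp (-A y κ))) - ((2 : ℂ)⁻¹ • (exp (A (y - e κ) κ) - exp (-A (y - e κ) κ)))) = 0 := by
  have hsk : ∀ X : Matrix n n ℂ, X ∈ skewAdjoint (Matrix n n ℂ) → (exp X)ᴴ = exp (-X) := fun X hX => by
    rw [← Matrix.exp_conjTranspose, ← Matrix.star_eq_conjTranspose, (skewAdjoint.mem_iff.mp hX)]
  have h' : ∑ κ : Fin d, ((exp (A y κ) - exp (-A y κ)) - (exp (A (y - e κ) κ) - exp (-A (y - e κ) κ))) = 0 := by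
    rw [← h]
    refine Finset.sum_congr rfl fun κ _ => ?_
    rw [(hW κ).1, (hW κ).2, val_expUnit, val_expUnit, hsk _ (hskew κ).1, hsk _ (hskew κ).2]
  simp_rw [← smul_sub]
  rw [← Finset.smul_sum, h', smul_zero]

/-! ## §2 The cube chart of F298 from the cube Landau minimiser's sup letter -/

set_option maxHeartbeats 1600000 in
/-- **THE CUBE CHART OF F298 FROM A LOCAL LANDAU GAUGE IN EULER–LAGRANGE FORM WITH THE SUP LETTER.**  `d = 4`, `L = 2`, `M = 2^{k+1}`, `t = r + 4(e^β − 1) + ε`: for `U` with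
`SmallField U (r∕M²)` and current `‖covDiv 1 U ν y‖ ≤ C·r∕M³` everywhere, a unitary `u₀` and `A` with `U^{u₀} = e^{A}`, `A` skew and `‖A‖ ≤ c₀t∕M` on the sup-cube of radius
`R₀ = (nbRad 4 2 + 2ℓ + 12)·M + 2` about `z`, and the lattice Landau condition (EL form) of `U^{u₀}` at every site of that cube, in the regime `t ≤ 1∕(1152(2ℓ+32)(c₀+1))`:
`‖A(p + e_τ, μ) − A(p, μ)‖ ≤ (62c₀ + (2ℓ+32)²(2C + 32c₀ + 48))·t∕M²` for `|p − z|_∞ ≤ (nbRad 4 2 + 2ℓ + 11)·M`. [folklore] -/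
theorem cubeChart_of_landauEL [Nonempty n] (ℓ k : ℕ) {U : Site 4 → Fin 4 → (Matrix n n ℂ)ˣ} {r ε β c₀ C : ℝ}
    (hr0 : 0 ≤ r) (hε0 : 0 ≤ ε) (hβ0 : 0 ≤ β) (hc₀ : 0 ≤ c₀) (hC : 0 ≤ C)
    (ht : r + 4 * (Real.exp β - 1) + ε ≤ 1 / (1152 * (2 * (ℓ : ℝ) + 32) * (c₀ + 1)))
    (hUr : SmallField U (r / (((2 : ℕ) : ℝ) ^ (k + 1)) ^ 2))
    (hcur : ∀ (ν : Fin 4) (y : Site 4), ‖covDiv 1 U ν y‖ ≤ C * r / (((2 : ℕ) : ℝ) ^ (k + 1)) ^ 3)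
    {u₀ : Site 4 → (Matrix n n ℂ)ˣ} (hu₀ : IsUnitarySite u₀) {A : Site 4 → Fin 4 → Matrix n n ℂ} (z : Site 4)
    (hUA : ∀ (p : Site 4) (μ : Fin 4), (∀ i, |p i - z i| ≤ (((nbRad 4 2 + 2 * ℓ + 12) * 2 ^ (k + 1) + 2 : ℕ) : ℤ)) → gaugeAct u₀ U p μ = expUnit (A p μ))
    (hskew : ∀ (p : Site 4) (μ : Fin 4), (∀ i, |p i - z i| ≤ (((nbRad 4 2 + 2 * ℓ + 12) * 2 ^ (k + 1) + 2 : ℕ) : ℤ)) → A p μ ∈ skewAdjoint (Matrix n n ℂ))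
    (hA0 : ∀ (p : Site 4) (μ : Fin 4), (∀ i, |p i - z i| ≤ (((nbRad 4 2 + 2 * ℓ + 12) * 2 ^ (k + 1) + 2 : ℕ) : ℤ)) →
      ‖A p μ‖ ≤ c₀ * (r + 4 * (Real.exp β - 1) + ε) / ((2 : ℕ) : ℝ) ^ (k + 1))
    (hEL : ∀ (y : Site 4), (∀ i, |y i - z i| ≤ (((nbRad 4 2 + 2 * ℓ + 12) * 2 ^ (k + 1) + 2 : ℕ) : ℤ)) →
      ∑ κ : Fin 4, ((((gaugeAct u₀ U y κ : (Matrix n n ℂ)ˣ) : Matrix n n ℂ) - ((gaugeAct u₀ U y κ : (Matrix n n ℂ)ˣ) : Matrix n n ℂ)ᴴ)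
        - (((gaugeAct u₀ U (y - e κ) κ : (Matrix n n ℂ)ˣ) : Matrix n n ℂ) - ((gaugeAct u₀ U (y - e κ) κ : (Matrix n n ℂ)ˣ) : Matrix n n ℂ)ᴴ)) = 0)
    (p : Site 4) (μ τ : Fin 4) (hp : ∀ i, |p i - z i| ≤ (((nbRad 4 2 + 2 * ℓ + 11) * 2 ^ (k + 1) : ℕ) : ℤ)) :
    ‖A (p + e τ) μ - A p μ‖
      ≤ (62 * c₀ + (2 * (ℓ : ℝ) + 32) ^ 2 * (2 * C + 32 * c₀ + 48 + 2 * 0)) * (r + 4 * (Real.exp β - 1) + ε) / (((2 : ℕ) : ℝ) ^ (k + 1)) ^ 2 := by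
  -- the EL reaction vanishes in the log chart on the cube of radius `R₀ − 2`
  have e1 : ∀ (a : Fin 4) (i : Fin 4), |(e a : Site 4) i| ≤ 1 := fun a i => by rw [e_apply]; split_ifs <;> simp
  have near1 : ∀ (x : Site 4) (a : Fin 4) (c : ℤ), (∀ i, |x i - z i| ≤ c) → ∀ i, |(x + e a) i - z i| ≤ c + 1 := fun x a c hx i => by
    have : |(x + e a) i - z i| ≤ |(e a : Site 4) i| + |x i - z i| := by
      rw [show (x + e a) i - z i = (e a : Site 4) i + (x i - z i) by simp; ring]; exact abs_add_le _ _
    linarith [e1 a i, hx i]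
  have near1m : ∀ (x : Site 4) (a : Fin 4) (c : ℤ), (∀ i, |x i - z i| ≤ c) → ∀ i, |(x - e a) i - z i| ≤ c + 1 := fun x a c hx i => by
    have : |(x - e a) i - z i| ≤ |(e a : Site 4) i| + |x i - z i| := by
      rw [show (x - e a) i - z i = -(e a : Site 4) i + (x i - z i) by simp; ring]
      exact (abs_add_le _ _).trans (by rw [abs_neg])
    linarith [e1 a i, hx i]
  have hdivS : ∀ (y : Site 4), (∀ i, |y i - z i| ≤ (((nbRad 4 2 + 2 * ℓ + 12) * 2 ^ (k + 1) + 2 : ℕ) : ℤ) - 1) →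
      ∑ κ : Fin 4, (((2 : ℂ)⁻¹ • (exp (A y κ) - exp (-A y κ))) - ((2 : ℂ)⁻¹ • (exp (A (y - e κ) κ) - exp (-A (y - e κ) κ)))) = 0 := by
    intro y hy
    have hy0 : ∀ i, |y i - z i| ≤ (((nbRad 4 2 + 2 * ℓ + 12) * 2 ^ (k + 1) + 2 : ℕ) : ℤ) := fun i => (hy i).trans (by linarith)
    have hym : ∀ κ : Fin 4, ∀ i, |(y - e κ) i - z i| ≤ (((nbRad 4 2 + 2 * ℓ + 12) * 2 ^ (k + 1) + 2 : ℕ) : ℤ) := fun κ i => by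
      linarith [near1m y κ _ hy i]
    exact sinhDiv_eq_zero_of_EL (gaugeAct u₀ U) A y (fun κ => ⟨hUA y κ hy0, hUA _ κ (hym κ)⟩) (fun κ => ⟨hskew y κ hy0, hskew _ κ (hym κ)⟩) (hEL y hy0)
  have hP : ∀ (y : Site 4) (ν : Fin 4), (∀ i, |y i - z i| ≤ (((nbRad 4 2 + 2 * ℓ + 12) * 2 ^ (k + 1) + 2 : ℕ) : ℤ) - 2) →
      ‖(∑ μ', (((2 : ℂ)⁻¹ • (exp (A (y + e ν) μ') - exp (-A (y + e ν) μ')))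
                - ((2 : ℂ)⁻¹ • (exp (A (y + e ν - e μ') μ') - exp (-A (y + e ν - e μ') μ'))))
          - ∑ μ', (((2 : ℂ)⁻¹ • (exp (A y μ') - exp (-A y μ'))) - ((2 : ℂ)⁻¹ • (exp (A (y - e μ') μ') - exp (-A (y - e μ') μ')))))‖
        ≤ 0 * (r + 4 * (Real.exp β - 1) + ε) / (((2 : ℕ) : ℝ) ^ (k + 1)) ^ 3 := by
    intro y ν hy
    have h1 := hdivS y (fun i => (hy i).trans (by linarith))
    have h2 := hdivS (y + e ν) (fun i => by linarith [near1 y ν _ hy i])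
    rw [h2, h1, sub_zero, norm_zero]; simp
  -- now the arithmetic of F302 with `c_r = 0`, after F303
  have hM2n : 2 ≤ 2 ^ (k + 1) :=
    calc 2 = 2 ^ 1 := by norm_num
      _ ≤ 2 ^ (k + 1) := Nat.pow_le_pow_right (by norm_num) (by omega)
  have hMr' : ((2 : ℕ) : ℝ) ^ (k + 1) = ((2 ^ (k + 1) : ℕ) : ℝ) := by rw [Nat.cast_pow]
  have hnb : nbRad 4 2 = 20 := by unfold BlockAverageVaryHolo.nbRad; norm_num
  rw [hnb] at hUA hA0 hp hP
  rw [hMr'] at hUr hcur hA0 hP ⊢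
  generalize hMdef : 2 ^ (k + 1) = Mn at *
  have hMr : (2 : ℝ) ≤ (Mn : ℝ) := by exact_mod_cast hM2n
  have hM0 : (0 : ℝ) < (Mn : ℝ) := by linarith
  set t : ℝ := r + 4 * (Real.exp β - 1) + ε with htdef
  have hβ' : 0 ≤ 4 * (Real.exp β - 1) := by nlinarith [Real.add_one_le_exp β]
  have hrt : r ≤ t := by rw [htdef]; linarith
  have ht0 : 0 ≤ t := hr0.trans hrt
  have hℓ0 : (0 : ℝ) ≤ (ℓ : ℝ) := Nat.cast_nonneg ℓ
  have hL' : (32 : ℝ) ≤ 2 * (ℓ : ℝ) + 32 := by linarith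
  have ht' : t ≤ 1 / (1024 * (2 * (ℓ : ℝ) + 32) * (c₀ + 1)) :=
    ht.trans (div_le_div_of_nonneg_left (by norm_num) (by positivity) (by nlinarith))
  have ht1 : t ≤ 1 := ht'.trans (by rw [div_le_one (by positivity)]; nlinarith)
  -- the absorption condition (EL form)
  have hρ0 : 0 ≤ c₀ * t / (Mn : ℝ) := by positivity
  have hct : (c₀ + 1) * t ≤ 1 / (1152 * (2 * (ℓ : ℝ) + 32)) := by
    rw [le_div_iff₀ (by positivity)] at ht; rw [le_div_iff₀ (by positivity)]; nlinarith
  have h4ρ : 4 * (c₀ * t / (Mn : ℝ)) ≤ 1 := by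
    rw [show 4 * (c₀ * t / (Mn : ℝ)) = 4 * (c₀ * t) / Mn by ring, div_le_one hM0]
    have h2 : 1 / (1152 * (2 * (ℓ : ℝ) + 32)) ≤ 1 / 1152 := by
      apply div_le_div_of_nonneg_left (by norm_num) (by norm_num); nlinarith
    nlinarith
  have hρ1 : c₀ * t / (Mn : ℝ) ≤ 1 := by linarith
  have hexp4 : Real.exp (4 * (c₀ * t / (Mn : ℝ))) - 1 ≤ 8 * (c₀ * t / (Mn : ℝ)) := by
    have := exp_sub_one_le_two_mul (by positivity : 0 ≤ 4 * (c₀ * t / (Mn : ℝ))) h4ρ; linarith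
  have hexp1 : Real.exp (c₀ * t / (Mn : ℝ)) - 1 ≤ 2 * (c₀ * t / (Mn : ℝ)) := exp_sub_one_le_two_mul hρ0 hρ1
  have hR2 : (((20 + 2 * ℓ + 12) * Mn + 2 - 2 : ℕ) : ℝ) = (2 * (ℓ : ℝ) + 32) * Mn := by
    rw [Nat.add_sub_cancel]; push_cast; ring
  have hs : 32 * ((3 + 1 : ℕ) : ℝ) * (((20 + 2 * ℓ + 12) * Mn + 2 - 2 : ℕ) : ℝ) * (Real.exp (4 * (c₀ * t / (Mn : ℝ))) - 1)
      + 16 * ((3 + 1 : ℕ) : ℝ) * (((20 + 2 * ℓ + 12) * Mn + 2 - 2 : ℕ) : ℝ) * (Real.exp (c₀ * t / (Mn : ℝ)) - 1) ≤ 1 := by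
    rw [hR2, show ((3 + 1 : ℕ) : ℝ) = 4 by norm_num]
    have h1 : 32 * 4 * ((2 * (ℓ : ℝ) + 32) * Mn) * (Real.exp (4 * (c₀ * t / (Mn : ℝ))) - 1)
        ≤ 32 * 4 * ((2 * (ℓ : ℝ) + 32) * Mn) * (8 * (c₀ * t / (Mn : ℝ))) := mul_le_mul_of_nonneg_left hexp4 (by positivity)
    have h2 : 16 * 4 * ((2 * (ℓ : ℝ) + 32) * Mn) * (Real.exp (c₀ * t / (Mn : ℝ)) - 1)
        ≤ 16 * 4 * ((2 * (ℓ : ℝ) + 32) * Mn) * (2 * (c₀ * t / (Mn : ℝ))) := mul_le_mul_of_nonneg_left hexp1 (by positivity)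
    have e1 : 32 * 4 * ((2 * (ℓ : ℝ) + 32) * Mn) * (8 * (c₀ * t / (Mn : ℝ))) + 16 * 4 * ((2 * (ℓ : ℝ) + 32) * Mn) * (2 * (c₀ * t / (Mn : ℝ)))
        = 1152 * (2 * (ℓ : ℝ) + 32) * (c₀ * t) := by field_simp; ring
    have h3 : 1152 * (2 * (ℓ : ℝ) + 32) * (c₀ * t) ≤ 1 := by
      have h4 : c₀ * t ≤ (c₀ + 1) * t := by nlinarith
      have h5 := mul_le_mul_of_nonneg_left (h4.trans hct) (by positivity : (0 : ℝ) ≤ 1152 * (2 * (ℓ : ℝ) + 32))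
      have e2 : 1152 * (2 * (ℓ : ℝ) + 32) * (1 / (1152 * (2 * (ℓ : ℝ) + 32))) = 1 := by field_simp
      linarith
    linarith
  -- F303 at `R₀ = (2ℓ+32)M + 2`, depth `M`
  have hR3 : 3 ≤ (20 + 2 * ℓ + 12) * Mn + 2 := by nlinarith
  have hcast : (((20 + 2 * ℓ + 12) * Mn + 2 : ℕ) : ℤ) - 2 = (((20 + 2 * ℓ + 12) * Mn : ℕ) : ℤ) := by push_cast; ring
  have h := norm_fdiff_le_of_landauEL_cube (d := 3) (n := n) (ε := r / (Mn : ℝ) ^ 2) (by positivity) hUr hu₀ z ((20 + 2 * ℓ + 12) * Mn + 2) hR3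
    (ρ := c₀ * t / (Mn : ℝ)) (j := C * r / (Mn : ℝ) ^ 3) (r := 0 * t / (Mn : ℝ) ^ 3) hρ0 (by positivity) (by positivity) hUA hA0
    (fun y ν hy => hcur ν y) (fun y ν hy => hP y ν hy) hs p Mn (by omega)
    (fun i => by have := hp i; push_cast at this ⊢; nlinarith [this]) μ τ
  rw [hR2] at h
  refine h.trans ?_
  have key := gradLetter_arith (M := (Mn : ℝ)) (L' := 2 * (ℓ : ℝ) + 32) (C := C) (c_r := 0) hMr hL' hr0 hrt ht1 hc₀ hC ht'
  refine le_trans (le_of_eq ?_) key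
  ring

/-! ## §3 (8)∃ from the sup letter of the cube Landau minimiser -/

set_option maxHeartbeats 1600000 in
/-- **F305 — (8)∃ FROM THE SUP LETTER OF THE CUBE LANDAU MINIMISER, SU(2)∕U(2) on T⁴, `L = 2`.**  [Balaban1985Variational] Thm 1 (8) ∘ Prop 8 ∘ a one-scale lattice
Uhlenbeck sup letter TYPE, rows NE7 ∘ NE3, `card n = 2`: for all `A ≥ 0` and `p` there are `ℓ ≥ 1`, `ε₀ > 0` and, for every `0 < ε ≤ ε₀`, a `β₀ > 0` such that for `0 < β ≤ β₀`,
every period `N ≥ 1` and all `c₀ ∈ [0, A(ℓ+1)^p]`: IF route Π's two `k`-free lines, (MSUP) — for every tangent-critical admissible configuration on the `(4ℓ+64)`-fold cover with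
small field `r ≤ ε∕4`, every centre `z` and every unitary site gauge `u`, `= 1` off the sup-cube `Q_z` of radius `R₀ = (nbRad 4 2 + 2ℓ + 12)·2^{k+1} + 2`, minimising the
trace-link functional over the bonds based in the cube of radius `R₀ + 1` among such gauges: `U^{u} = e^{A}` on `Q_z` with `A` skew and `‖A‖ ≤ c₀t∕M` there — and row NE3's
`hleaves` hold, THEN for some `δ_V > 0`, over `{V | unitary, N-periodic, SmallField V δ_V}`, at every level some constrained minimiser over `sfClass 4 2 N ε` is `SmallField U a`
with `0 ≤ a < ε∕(2^k)²`.  The minimising gauge EXISTS and is Landau (F304); its gradient letter follows (F303, F301); NE7 is NOT proved unconditionally ((MSUP), `hleaves`, the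
two lines remain). -/
theorem hint_of_landauMinSup_SU2 [Nonempty n] (hn : Fintype.card n = 2) {A : ℝ} (hA : 0 ≤ A) (p : ℕ) :
    ∃ ℓ : ℕ, 1 ≤ ℓ ∧ ∃ ε₀ : ℝ, 0 < ε₀ ∧ ∀ ε : ℝ, 0 < ε → ε ≤ ε₀ → ∃ β₀ : ℝ, 0 < β₀ ∧ ∀ β : ℝ, 0 < β → β ≤ β₀ →
    ∀ (N : ℕ) [NeZero N] (C₂ αh Ch νh κh c₀ : ℝ), 1 ≤ N →
    0 ≤ C₂ → 0 ≤ αh → αh ≤ 1 → 0 ≤ Ch →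
    νh = 2 * Real.sqrt (l2C 4 2 / (1 - thetaLoc 4 2 * ε) ^ 2 + curl2C 4 2 / (1 - thetaLoc 4 2 * ε) ^ 2) * C₂ * Ch * αh →
    κh = 4 * (curl1C 4 2 / (1 - thetaLoc 4 2 * ε)) * C₂ * Ch ^ 2 * ε →
    νh < 1 →
    2 * (κh / (1 - νh) ^ 2) < ((((1 / 2 - (νh / (1 - νh)) ^ 2) / (2 * (1 + (CPLine 4 2 2 (1 / 10 ^ 17) (1 / 10 ^ 53) + 1))) - (νh / (1 - νh)) ^ 2) / 2 - 576 * ((4 : ℕ) : ℝ) * (αh ^ 2 * Real.exp (2 * αh))) / (Fintype.card n : ℝ) - 28 * ((4 : ℕ) : ℝ) * (ε + 7 * αh ^ 2)) →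
    0 ≤ c₀ → c₀ ≤ A * ((ℓ : ℝ) + 1) ^ p →
    -- (MSUP): the sup letter of the cube Landau minimiser, on the `(4ℓ+64)`-fold cover
    (∀ D : Site 4 → Fin 4 → (Matrix n n ℂ)ˣ, IsUnitaryCfg D → IsPeriodicCfg D ((N * (4 * ℓ + 64)) : ℤ) → SmallField D (4 * (Real.exp β - 1)) →
      ∀ (k : ℕ), ∀ U ∈ admissible (sfClass 4 2 (N * (4 * ℓ + 64)) ε) 2 (k + 1) D,
      (∀ φ : Site 4 → Fin 4 → Matrix n n ℂ, IsSkewDir φ → IsPeriodicDir φ (((N * (4 * ℓ + 64)) * 2 ^ (k + 1) : ℕ) : ℤ) → TangentIter 2 k U φ →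
        dAction U φ (perWin 4 ((N * (4 * ℓ + 64)) * 2 ^ (k + 1))) = 0) →
      ∀ r : ℝ, 0 ≤ r → r ≤ (1 / ((2 : ℕ) : ℝ) ^ 2 * ε) → SmallField U (r / (((2 : ℕ) : ℝ) ^ (k + 1)) ^ 2) →
      ∀ (z : Site 4) (u : Site 4 → (Matrix n n ℂ)ˣ), (∀ x, u x ∈ unitaryUnits (Matrix n n ℂ)) →
        (∀ x, x ∉ Finset.Icc (z - fun _ => (((nbRad 4 2 + 2 * ℓ + 12) * 2 ^ (k + 1) + 2 : ℕ) : ℤ)) (z + fun _ => (((nbRad 4 2 + 2 * ℓ + 12) * 2 ^ (k + 1) + 2 : ℕ) : ℤ)) → u x = 1) →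
        (∀ v : Site 4 → (Matrix n n ℂ)ˣ, (∀ x, v x ∈ unitaryUnits (Matrix n n ℂ)) →
          (∀ x, x ∉ Finset.Icc (z - fun _ => (((nbRad 4 2 + 2 * ℓ + 12) * 2 ^ (k + 1) + 2 : ℕ) : ℤ)) (z + fun _ => (((nbRad 4 2 + 2 * ℓ + 12) * 2 ^ (k + 1) + 2 : ℕ) : ℤ)) → v x = 1) →
          ∑ x ∈ Finset.Icc (z - fun _ => (((nbRad 4 2 + 2 * ℓ + 12) * 2 ^ (k + 1) + 2 + 1 : ℕ) : ℤ)) (z + fun _ => (((nbRad 4 2 + 2 * ℓ + 12) * 2 ^ (k + 1) + 2 + 1 : ℕ) : ℤ)), ∑ κ : Fin 4, (1 - nReTr ((gaugeAct u U x κ : (Matrix n n ℂ)ˣ) : Matrix n n ℂ))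
            ≤ ∑ x ∈ Finset.Icc (z - fun _ => (((nbRad 4 2 + 2 * ℓ + 12) * 2 ^ (k + 1) + 2 + 1 : ℕ) : ℤ)) (z + fun _ => (((nbRad 4 2 + 2 * ℓ + 12) * 2 ^ (k + 1) + 2 + 1 : ℕ) : ℤ)), ∑ κ : Fin 4, (1 - nReTr ((gaugeAct v U x κ : (Matrix n n ℂ)ˣ) : Matrix n n ℂ))) →
        ∃ A : Site 4 → Fin 4 → Matrix n n ℂ,
          (∀ (p : Site 4) (μ : Fin 4), (∀ i, |p i - z i| ≤ (((nbRad 4 2 + 2 * ℓ + 12) * 2 ^ (k + 1) + 2 : ℕ) : ℤ)) → A p μ ∈ skewAdjoint (Matrix n n ℂ)) ∧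
          (∀ (p : Site 4) (μ : Fin 4), (∀ i, |p i - z i| ≤ (((nbRad 4 2 + 2 * ℓ + 12) * 2 ^ (k + 1) + 2 : ℕ) : ℤ)) → gaugeAct u U p μ = expUnit (A p μ)) ∧
          (∀ (p : Site 4) (μ : Fin 4), (∀ i, |p i - z i| ≤ (((nbRad 4 2 + 2 * ℓ + 12) * 2 ^ (k + 1) + 2 : ℕ) : ℤ)) →
            ‖A p μ‖ ≤ c₀ * (r + 4 * (Real.exp β - 1) + ε) / ((2 : ℕ) : ℝ) ^ (k + 1))) →
    -- ROW NE3's PER-PAIR BINDER on the data class (F31's `hleaves`)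
    (∀ D : Site 4 → Fin 4 → (Matrix n n ℂ)ˣ, IsUnitaryCfg D → IsPeriodicCfg D (N : ℤ) → SmallField D (4 * (Real.exp β - 1)) → ∀ (k : ℕ), ∀ Us ∈ admissible (sfClass 4 2 N ε) 2 (k + 1) D, SmallField Us ((1 / ((2 : ℕ) : ℝ) ^ 2 * ε / 2) / (((2 : ℕ) : ℝ) ^ (k + 1)) ^ 2) → (∀ φ : Site 4 → Fin 4 → Matrix n n ℂ, IsSkewDir φ → IsPeriodicDir φ ((N * 2 ^ (k + 1) : ℕ) : ℤ) → TangentIter 2 k Us φ → dAction Us φ (perWin 4 (N * 2 ^ (k + 1))) = 0) → ∀ U' ∈ admissible (sfClass 4 2 N ε) 2 (k + 1) D, ∃ (u : Site 4 → (Matrix n n ℂ)ˣ) (X₀ : Site 4 → Fin 4 → Matrix n n ℂ) (α₀ : ℝ) (m : Site 4 → Fin 4 → ℝ) (C : ℝ), IsSkewDir X₀ ∧ (∀ (hWu : IsUnitaryCfg Us) (hx : 0 ≤ ε / (((2 : ℕ) : ℝ) ^ (k + 1)) ^ 2) (hs : LevelSmall 4 2 k (ε / (((2 : ℕ) : ℝ)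 ^ (k + 1)) ^ 2)) (hWx : SmallField Us (ε / (((2 : ℕ) : ℝ) ^ (k + 1)) ^ 2)) (hθ : cruxC 4 2 * ((((2 : ℕ) : ℝ) ^ (k + 1)) ^ 2 * (ε / (((2 : ℕ) : ℝ) ^ (k + 1)) ^ 2)) < 1) (hφ : IsSkewDir (dirIter 2 (k + 1) Us X₀)), ResidualSliceRepT 2 N (k + 1) Us U' u X₀ (rightInvW (by norm_num) k hWu hx hs hWx N hθ hφ) α₀) ∧ (∀ z κ, 0 ≤ m z κ) ∧ 0 ≤ C ∧ (((2 : ℕ) : ℝ) ^ (k + 1)) ^ 4 * ∑ z ∈ periodBox (d := 4) N, ∑ κ : Fin 4, m z κ ^ 2 ≤ C ^ 2 * dirSq X₀ (periodBox (d := 4) (N * 2 ^ (k + 1))) ∧ (∀ z ∈ periodBox (d := 4) N, ∀ κ : Fin 4, ‖dirIter 2 (k + 1) Us X₀ z κ‖ ≤ C₂ * (((2 : ℕ) : ℝ) ^ (k + 1) * m z κ) ^ 2) ∧ α₀ * ((2 : ℕ) : ℝ) ^ (k + 1) ≤ αh ∧ (∀ z κ, m z κ * ((2 : ℕ) : ℝ)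 ^ (k + 1) ≤ αh) ∧ C ≤ Ch) →
    ∃ δV : ℝ, 0 < δV ∧
      ∀ V ∈ {V : Site 4 → Fin 4 → (Matrix n n ℂ)ˣ | IsUnitaryCfg V ∧ IsPeriodicCfg V (N : ℤ) ∧ SmallField V δV},
      ∀ k : ℕ, ∃ U : Site 4 → Fin 4 → (Matrix n n ℂ)ˣ, IsMinimiser 4 (sfClass 4 2 N ε) 2 N k V U ∧
        ∃ a : ℝ, 0 ≤ a ∧ a < ε / (((2 : ℕ) : ℝ) ^ k) ^ 2 ∧ SmallField U a := by
  obtain ⟨C, hC0, hC⟩ := exists_classCurrentConst (n := n)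
  set A' : ℝ := 62 * A + 1024 * (2 * C + 48) + 34816 * A with hA'
  have hA'0 : 0 ≤ A' := by positivity
  obtain ⟨ℓ, hℓ1, ε₀, hε₀, H⟩ := hint_of_cubeChart_SU2 (n := n) hn (A := A') hA'0 (p + 2)
  have hℓ0 : (0 : ℝ) ≤ (ℓ : ℝ) := Nat.cast_nonneg ℓ
  set T : ℝ := 1 / (1152 * (2 * (ℓ : ℝ) + 32) * (A * ((ℓ : ℝ) + 1) ^ p + 1)) with hT
  have hT0 : 0 < T := by positivity
  refine ⟨ℓ, hℓ1, min ε₀ (min (1 / 10 ^ 53) (T / 3)), lt_min hε₀ (lt_min (by norm_num) (by positivity)), fun ε hε hεle => ?_⟩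
  obtain ⟨β₀, hβ₀, H2⟩ := H ε hε (hεle.trans (min_le_left _ _))
  refine ⟨min β₀ (min 1 (T / 24)), lt_min hβ₀ (lt_min one_pos (by positivity)), ?_⟩
  intro β hβ hβle N _ C₂ αh Ch νh κh c₀ hN hC₂ hαh0 hαh1 hCh0 hνh hκh hν hline hc₀ hc₀b hMSUP hleaves
  have hε53 : ε ≤ 1 / 10 ^ 53 := hεle.trans ((min_le_right _ _).trans (min_le_left _ _))
  have hεT : ε ≤ T / 3 := hεle.trans ((min_le_right _ _).trans (min_le_right _ _))
  have hβ1 : β ≤ 1 := hβle.trans ((min_le_right _ _).trans (min_le_left _ _))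
  have hβT : β ≤ T / 24 := hβle.trans ((min_le_right _ _).trans (min_le_right _ _))
  have hexpβ : 4 * (Real.exp β - 1) ≤ T / 3 := by
    have h := exp_sub_one_le_two_mul hβ.le hβ1; linarith
  -- the derived gradient constant and its polynomial bound
  set c₁ : ℝ := 62 * c₀ + (2 * (ℓ : ℝ) + 32) ^ 2 * (2 * C + 32 * c₀ + 48 + 2 * 0) with hc₁
  have hc₁0 : 0 ≤ c₁ := by positivity
  have hpow2 : ((ℓ : ℝ) + 1) ^ p ≤ ((ℓ : ℝ) + 1) ^ (p + 2) := pow_le_pow_right₀ (by linarith) (by omega)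
  have hsq : (2 * (ℓ : ℝ) + 32) ^ 2 ≤ 1024 * ((ℓ : ℝ) + 1) ^ 2 := by nlinarith
  have hpow_eq : ((ℓ : ℝ) + 1) ^ (p + 2) = ((ℓ : ℝ) + 1) ^ 2 * ((ℓ : ℝ) + 1) ^ p := by ring
  have hQ : 0 ≤ A * ((ℓ : ℝ) + 1) ^ p := by positivity
  have hc₁b : c₁ ≤ A' * ((ℓ : ℝ) + 1) ^ (p + 2) := by
    have h1 : 2 * C + 32 * c₀ + 48 + 2 * 0 ≤ 2 * C + 48 + 34 * (A * ((ℓ : ℝ) + 1) ^ p) := by linarith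
    have h2 : (2 * (ℓ : ℝ) + 32) ^ 2 * (2 * C + 32 * c₀ + 48 + 2 * 0) ≤ (1024 * ((ℓ : ℝ) + 1) ^ 2) * (2 * C + 48 + 34 * (A * ((ℓ : ℝ) + 1) ^ p)) :=
      mul_le_mul hsq h1 (by positivity) (by positivity)
    have h3 : 62 * c₀ ≤ 62 * A * ((ℓ : ℝ) + 1) ^ (p + 2) := by nlinarith
    have h4 : (1024 * ((ℓ : ℝ) + 1) ^ 2) * (2 * C + 48 + 34 * (A * ((ℓ : ℝ) + 1) ^ p))
        = 1024 * (2 * C + 48) * ((ℓ : ℝ) + 1) ^ 2 + 34816 * A * ((ℓ : ℝ) + 1) ^ (p + 2) := by rw [hpow_eq]; ring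
    have h5 : 1024 * (2 * C + 48) * ((ℓ : ℝ) + 1) ^ 2 ≤ 1024 * (2 * C + 48) * ((ℓ : ℝ) + 1) ^ (p + 2) := by
      have : ((ℓ : ℝ) + 1) ^ 2 ≤ ((ℓ : ℝ) + 1) ^ (p + 2) := pow_le_pow_right₀ (by linarith) (by omega)
      exact mul_le_mul_of_nonneg_left this (by positivity)
    rw [hc₁, hA']; nlinarith
  have hc₀b' : c₀ ≤ A' * ((ℓ : ℝ) + 1) ^ (p + 2) := by
    have h1 : A * ((ℓ : ℝ) + 1) ^ p ≤ A * ((ℓ : ℝ) + 1) ^ (p + 2) := mul_le_mul_of_nonneg_left hpow2 hA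
    have h2 : A * ((ℓ : ℝ) + 1) ^ (p + 2) ≤ A' * ((ℓ : ℝ) + 1) ^ (p + 2) := by
      apply mul_le_mul_of_nonneg_right _ (by positivity); rw [hA']; nlinarith
    linarith
  refine H2 β hβ (hβle.trans (min_le_left _ _)) N C₂ αh Ch νh κh c₀ c₁ hN hC₂ hαh0 hαh1 hCh0 hνh hκh hν hline hc₀ hc₀b' hc₁0 hc₁b ?_ hleaves
  -- (CUBE) from (MSUP): the minimiser exists (F304), is Landau at every site of the cube, and (MSUP) gives its log chart
  intro D hDu hDP hDs k U hU hcrit r hr0 hr hUr z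
  haveI : NeZero (N * (4 * ℓ + 64)) := ⟨mul_ne_zero (NeZero.ne N) (by omega)⟩
  have hr4 : r ≤ ε / 4 := by have e := hr; norm_num at e; linarith
  have hr14 : r ≤ 1 / 4 := by linarith [hε53.trans (by norm_num : (1 : ℝ) / 10 ^ 53 ≤ 1)]
  have hcur := hC (N * (4 * ℓ + 64)) ε hε hε53 D k U hU hcrit r hr0 hr14 hUr
  -- the cube `Q` of radius `R₀` and the base set `B` of radius `R₀ + 1`
  obtain ⟨u, hu, huQ, hmin⟩ := exists_cubeTraceLinkMinimiser
    (Finset.Icc (z - fun _ => (((nbRad 4 2 + 2 * ℓ + 12) * 2 ^ (k + 1) + 2 + 1 : ℕ) : ℤ)) (z + fun _ => (((nbRad 4 2 + 2 * ℓ + 12) * 2 ^ (k + 1) + 2 + 1 : ℕ) : ℤ)))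
    (Finset.Icc (z - fun _ => (((nbRad 4 2 + 2 * ℓ + 12) * 2 ^ (k + 1) + 2 : ℕ) : ℤ)) (z + fun _ => (((nbRad 4 2 + 2 * ℓ + 12) * 2 ^ (k + 1) + 2 : ℕ) : ℤ))) U
  obtain ⟨A₀, hskew, hUA, hA0⟩ := hMSUP D hDu hDP hDs k U hU hcrit r hr0 hr hUr z u hu huQ hmin
  -- Euler–Lagrange at every site of `Q`
  have hEL : ∀ (y : Site 4), (∀ i, |y i - z i| ≤ (((nbRad 4 2 + 2 * ℓ + 12) * 2 ^ (k + 1) + 2 : ℕ) : ℤ)) →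
      ∑ κ : Fin 4, ((((gaugeAct u U y κ : (Matrix n n ℂ)ˣ) : Matrix n n ℂ) - ((gaugeAct u U y κ : (Matrix n n ℂ)ˣ) : Matrix n n ℂ)ᴴ)
        - (((gaugeAct u U (y - e κ) κ : (Matrix n n ℂ)ˣ) : Matrix n n ℂ) - ((gaugeAct u U (y - e κ) κ : (Matrix n n ℂ)ˣ) : Matrix n n ℂ)ᴴ)) = 0 := by
    intro y hy
    have e1 : ∀ (a : Fin 4) (i : Fin 4), |(e a : Site 4) i| ≤ 1 := fun a i => by rw [e_apply]; split_ifs <;> simp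
    refine landau_of_isMin_cube _ _ hu huQ hmin ((mem_cube_iff z _ y).mpr hy) ((mem_cube_iff z _ y).mpr fun i => (hy i).trans (by push_cast; linarith)) ?_
    intro κ
    refine (mem_cube_iff z _ _).mpr fun i => ?_
    have : |(y - e κ) i - z i| ≤ |(e κ : Site 4) i| + |y i - z i| := by
      rw [show (y - e κ) i - z i = -(e κ : Site 4) i + (y i - z i) by simp; ring]
      exact (abs_add_le _ _).trans (by rw [abs_neg])
    have hyi := hy i
    push_cast at hyi ⊢; linarith [e1 κ i, hyi]
  -- the regime
  have ht : r + 4 * (Real.exp β - 1) + ε ≤ 1 / (1152 * (2 * (ℓ : ℝ) + 32) * (c₀ + 1)) := by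
    have h1 : r + 4 * (Real.exp β - 1) + ε ≤ T := by linarith
    have h2 : T ≤ 1 / (1152 * (2 * (ℓ : ℝ) + 32) * (c₀ + 1)) := by
      rw [hT]; apply div_le_div_of_nonneg_left (by norm_num) (by positivity)
      exact mul_le_mul_of_nonneg_left (by linarith) (by positivity)
    linarith
  -- radii
  have hsub : ∀ (q : Site 4), (∀ i, |q i - z i| ≤ (((nbRad 4 2 + 2 * ℓ + 11) * 2 ^ (k + 1) : ℕ) : ℤ)) →
      ∀ i, |q i - z i| ≤ (((nbRad 4 2 + 2 * ℓ + 12) * 2 ^ (k + 1) + 2 : ℕ) : ℤ) := fun q hq i =>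
    (hq i).trans (by push_cast; nlinarith [show (1 : ℤ) ≤ 2 ^ (k + 1) by exact_mod_cast Nat.one_le_two_pow])
  refine ⟨u, A₀, hu, fun q μ hq => hUA q μ (hsub q hq), fun q μ hq => hskew q μ (hsub q hq), fun q μ hq => hA0 q μ (hsub q hq), fun q μ τ hq _ => ?_⟩
  exact cubeChart_of_landauEL (n := n) ℓ k hr0 hε.le hβ.le hc₀ hC0 ht hUr hcur hu z hUA hskew hA0 hEL q μ τ hq

end

end Summit.QuantumFields.BalabanUV.T4Continuum.NE7HintOfLandauMinSupSU2
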